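import Mathlib.Analysis.InnerProductSpace.PiL2
import Mathlib.Analysis.Calculus.FDeriv.Basic
import Mathlib.Analysis.Calculus.FDeriv.Equiv
import Mathlib.Analysis.Calculus.ContDiff.Defs
import Mathlib.Analysis.Complex.Basic
import Mathlib.Analysis.SpecialFunctions.Complex.Circle
import Mathlib.Algebra.Order.Chebyshev
import Mathlib.MeasureTheory.Integral.Lebesgue.Basic
import Mathlib.MeasureTheory.Integral.Lebesgue.Add
import Mathlib.MeasureTheory.Measure.Lebesgue.Complex
import Mathlib.MeasureTheory.Constructions.Pi
import Literature.Probability.LatticeModels.LatticeGraph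
import Literature.MathematicalPhysics.QuantumManyBody.PeriodicBoseGas
import HarnessLib

/-!
# The lattice relativistic Bose gas (canonical, variational form)

Topic `Literature/MathematicalPhysics/QuantumLattice` (definition item
`defn-RelativisticLatticeBoseGas`, wanted by route BECSilverBlazeRP of
`AtomisticToContinuum/BoseEinsteinCondensation`, items RelCornerLRO / AnchorLRO /
ChargedAnchorLRO, which typed the objects below inline with `let`s).

**The model.** The charged (complex) scalar field with quartic self-interaction,
`ℒ = ∂_μΦ^* ∂^μΦ - m²Φ^*Φ - λ(Φ^*Φ)²`, has the global `U(1)` symmetry `Φ ↦ e^{-iα}Φ`, the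
conserved charge `Q = ∫ (φ₂π₁ - φ₁π₂)` and the Hamiltonian density
`ℋ = ½[π₁² + π₂² + (∇φ₁)² + (∇φ₂)² + m²(φ₁² + φ₂²)] + ¼λ(φ₁² + φ₂²)²`
(`Φ = (φ₁ + iφ₂)/√2`); its grand-canonical partition function `Tr e^{-β(H - μQ)}` describes the
*relativistic Bose gas at chemical potential `μ`*, whose `T = 0` onset of a non-zero charge
density at `|μ| = m_phys` ("Silver Blaze") is Bose–Einstein condensation of a dilute gas of
particles [KapustaGale2023, §2.4 (2.43)–(2.52)]; on the Euclidean lattice `N_s³ × N_t` this is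
the action `S = ∑ₓ (η|φₓ|² + λ|φₓ|⁴ - ∑_ν [e^{μδ_{ν,4}} φₓ^* φ_{x+ν̂} + e^{-μδ_{ν,4}} φₓ^* φ_{x-ν̂}])`
of finite-density lattice field theory [GattringerKloiber2013, §2 (1)], [Aarts2009, (1)], with
`μ` on the temporal links [HasenfratzKarsch1983], complex for `μ ≠ 0` (the "complex action
problem").

**What is formalised** is the *canonical* (Hamiltonian, temporal-continuum) version on the
spatial torus `(ℤ/nℤ)^d`, in the operator-free variational style of
`Literature.MathematicalPhysics.QuantumManyBody.BoseGas` (`BoseEinsteinCondensation.lean`,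
`PeriodicBoseGas.lean`), in lattice units `ħ = 1`: one complex coordinate `Φₓ ∈ ℂ ≅ ℝ²` per
site (`Config d n = TorusSite d n → ℂ`, Lebesgue (pi) volume), wave functions
`Ψ : Config d n → ℂ` (Schrödinger / field-coordinate representation, `πₓ ↦ -i∂/∂Φₓ`: a
"quantum anharmonic crystal" of two-component oscillators, the setting of
[DriesslerLandauPerez1979]), and the quadratic form of
`H = ∑ₓ [(c²/2)(-Δ_{Φₓ}) + W(|Φₓ|²)] + ∑ₓ ∑ᵢ |Φ_{x+eᵢ} - Φₓ|² + ½ ∑ₓ ∑_y K(x,y) |Φₓ|² |Φ_y|²`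
(`Δ_{Φₓ} = ∂²_{Re Φₓ} + ∂²_{Im Φₓ}`), with a site potential `W : ℝ → ℝ≥0∞` of `|Φₓ|²` (so `H`
is `U(1)`-invariant by construction; instances `doubleWell lam w : t ↦ lam (t - w)²` and
`massTerm c : t ↦ (c²/2) t`) and a density–density kernel `K ≥ 0` (instance `bornKernel`, the
discretised periodic pair potential of `PeriodicBoseGas`). Instead of a chemical potential the
statements fix the **charge sector**: `IsInSector N Ψ :↔ Ψ(e^{iθ}Φ) = e^{iNθ} Ψ(Φ)` for all
`θ`, i.e. `Ψ` is an eigenfunction, with eigenvalue `N`, of the charge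
`Q = ∑ₓ (-i ∂/∂θₓ)` (`θₓ = arg Φₓ`) generating the gauge rotation — the canonical counterpart of
`μ`, free of complex weights (`H` commutes with `Q`; `Tr_{Q=N} e^{-βH} = ∮ Tr e^{-βH + iαQ} e^{-iαN}`).
Provided: `kineticDensity`, `gradientEnergy`, `potential`, `energy` (`ℝ≥0∞`-valued lower
Lebesgue integrals), `TrialState` (`C¹`, normalised), `groundStateEnergy`,
`sectorGroundStateEnergy N = inf over sector-N trial states`, the **zero-mode intensity**
`zeroModeIntensity Ψ = ∫ |∑ₓ Φₓ|² |Ψ|²` (order parameter) and `siteIntensity`, the ground-state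
order parameters through minimising sequences `groundStateZeroMode`, `sectorZeroMode`
(as `BoseGas.condensateNumber`), and the two models of the route: `anchor d n c lam w`
(`W = doubleWell`, `K = 0`: the charge-conjugation symmetric point) and `corner n c v ρ N`
(`W = massTerm c`, `K = bornKernel v (sideLength ρ N) n`: the non-relativistic corner).

**Dictionary** (standard; recorded, not proved). The on-site operator
`(c²/2)(-Δ_Φ) + (c²/2)|Φ|²` is a pair of oscillators of frequency `c²` (`= mc²`, mass `1`), and
`Φₓ = aₓ† + bₓ` exactly, with `aₓ† ` creating a quantum of charge `+1` and `bₓ` annihilating one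
of charge `-1` (`Q = ∑ₓ (aₓ†aₓ - bₓ†bₓ)`); the gradient term gives both species nearest-neighbour
hopping of amplitude `1`, and `|∑ₓ Φₓ|² = n^d (a₀a₀† + b₀†b₀ + a₀b₀ + b₀†a₀†)` has expectation
`n^d (N₀ + 1)` in states without antiparticles (`N₀` = zero-momentum occupation): this is why
`zeroModeIntensity ≥ κ N n^d` expresses condensation. Complex conjugation of the wave function
maps sector `N` onto sector `-N` preserving the energy (`sectorGroundStateEnergy_neg`: particles
and antiparticles are interchangeable), and `N = 0` contains the absolute ground state when the
latter is unique.

**Design choices.** `ℝ≥0∞` throughout (no junk from empty infima: `⊤`); `[NeZero n]` for the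
finite torus; `d` general (the route uses `d = 3`; `latticePos`/`bornKernel`/`corner` are
`d = 3` as they live on `BoseGas.Space = ℝ³`); `c` enters only through `c²/2`; `W` may take the
value `⊤` (hard constraints) and `doubleWell lam w` clips to `0` for `lam < 0` (junk, unused);
only the symmetric part of `K` matters. Trial states are `C¹` with `∫|Ψ|² = 1` on all of
`ℂ^{n^d}` (no decay imposed: infinite energy is allowed and harmless in infima). Mathlib has no
lattice field Hamiltonians (`lean search` for Bose–Hubbard / lattice boson / relativistic:
nothing); reused: `TorusSite`, `BoseGas.periodizedPotential`, `BoseGas.sideLength`, `fderiv`,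
`lintegral`, `Measure.pi`, Lebesgue measure on `ℂ`. NOT here: the Euclidean action / transfer
matrix and reflection positivity, the `c → ∞` companion lattice Bose gas (separate file), the
`U(1)`-invariance of `energy` under `Ψ ↦ Ψ ∘ phaseRotate θ` (change of variables; separate
file), positive temperature.

## References

* [KapustaGale2023] J. I. Kapusta, C. Gale, *Finite-Temperature Field Theory*, CUP, §2.4
  (2.43)–(2.52): charged scalar field, `U(1)` charge, Hamiltonian, chemical potential, BEC.
* [GattringerKloiber2013] C. Gattringer, T. Kloiber, Nucl. Phys. B 869 (2013) 56, §2 eq. (1)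
  (arXiv:1206.2954): lattice charged `φ⁴` at finite `μ`, Silver Blaze, dual representation.
* [Aarts2009] G. Aarts, PRL 102 (2009) 131601, eq. (1); [HasenfratzKarsch1983] PLB 125 (1983) 308.
* [DriesslerLandauPerez1979] Driessler–Landau–Perez, J. Stat. Phys. 20 (1979) 123 (anharmonic crystals).
* [LSSY2005] Lieb–Seiringer–Solovej–Yngvason, *The Mathematics of the Bose Gas…*, Ch. 2, Ch. 11.
-/

noncomputable section

open MeasureTheory Filter
open scoped ENNReal NNReal ComplexConjugate

namespace Literature.MathematicalPhysics.QuantumLattice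

open Literature.Probability.LatticeModels (TorusSite)

/-- The data of a **lattice relativistic Bose gas** on the spatial torus `(ℤ/nℤ)^d` in the
canonical, field-coordinate form: the Hamiltonian
`H = ∑ₓ [(c²/2)(-Δ_{Φₓ}) + W(|Φₓ|²)] + ∑ₓ ∑ᵢ |Φ_{x+eᵢ} - Φₓ|² + ½ ∑ₓ ∑_y K(x,y) |Φₓ|² |Φ_y|²`
acting on wave functions `Ψ(Φ)`, `Φ ∈ ℂ^{(ℤ/nℤ)^d}` — the lattice Hamiltonian of the charged
scalar field `ℋ = ½[π₁² + π₂² + (∇φ₁)² + (∇φ₂)² + m²(φ₁² + φ₂²)] + ¼λ(φ₁² + φ₂²)²` (Kapusta–Gale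
(2.48)) with speed of light `c`, a general `U(1)`-invariant site potential `W(|Φ|²)` and a
general density–density kernel `K` (the route's smeared quartic coupling).
[cite: KapustaGale2023, §2.4 (2.43)–(2.49)] -/
structure RelativisticLatticeBoseGas (d n : ℕ) where
  /-- The speed of light `c`: the kinetic (field-momentum) term is `(c²/2)(-Δ_{Φₓ})`. -/
  c : ℝ
  /-- The on-site potential, as a function of `t = |Φₓ|²` (value `⊤` allowed). -/
  W : ℝ → ℝ≥0∞
  /-- The density–density pair kernel `K(x,y) ∈ [0, ∞]` multiplying `½ |Φₓ|² |Φ_y|²`. -/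
  K : TorusSite d n → TorusSite d n → ℝ≥0∞

namespace RelativisticLatticeBoseGas

variable {d n : ℕ}

/-! ### Configurations, gauge rotations, charge sectors -/

/-- Field configurations: one complex coordinate `Φₓ` per site of the torus `(ℤ/nℤ)^d`
(`ℂ^{n^d} ≅ ℝ^{2n^d}` with Lebesgue measure, the product of the Lebesgue measures on `ℂ`).
[cite: KapustaGale2023, §2.4 (2.48)] -/
abbrev Config (d n : ℕ) : Type := TorusSite d n → ℂ

/-- The global gauge (`U(1)`) rotation `Φ ↦ e^{iθ} Φ` of a configuration.
[cite: KapustaGale2023, §2.4 (2.44)] -/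
def phaseRotate (θ : ℝ) (Φ : Config d n) : Config d n :=
  fun x => Complex.exp (θ * Complex.I) * Φ x

/-- **Charge sector `N`.** The wave function `Ψ` transforms under the global gauge rotation as
`Ψ(e^{iθ}Φ) = e^{iNθ} Ψ(Φ)` for all `θ`: it is an eigenfunction with eigenvalue `N ∈ ℤ` of the
conserved charge `Q = ∑ₓ (-i∂/∂θₓ)` (lattice version of `Q = ∫(φ₂π₁ - φ₁π₂)`, the generator of
(2.44)), which commutes with `H`. Fixing the sector is the canonical counterpart of a chemical
potential. [cite: KapustaGale2023, §2.4 (2.44)–(2.49)] -/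
def IsInSector (N : ℤ) (Ψ : Config d n → ℂ) : Prop :=
  ∀ (θ : ℝ) (Φ : Config d n), Ψ (phaseRotate θ Φ) = Complex.exp (N * θ * Complex.I) * Ψ Φ

variable [NeZero n]

/-! ### The quadratic form of `H` -/

/-- The kinetic (field-momentum) density `∑ₓ (|∂Ψ/∂(Re Φₓ)|² + |∂Ψ/∂(Im Φₓ)|²)` of a wave
function at `Φ`: squared real Fréchet derivatives along the coordinate directions `eₓ` and
`i eₓ` (`0` where `Ψ` is not differentiable, by `fderiv`'s convention). This is `⟨π₁² + π₂²⟩`'s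
density with `π = -i∂/∂φ` (Kapusta–Gale (2.48)). [cite: KapustaGale2023, §2.4 (2.48)] -/
def kineticDensity (Ψ : Config d n → ℂ) (Φ : Config d n) : ℝ≥0∞ :=
  ∑ x, ((‖fderiv ℝ Ψ Φ (Pi.single x 1)‖₊ : ℝ≥0∞) ^ 2 +
    (‖fderiv ℝ Ψ Φ (Pi.single x Complex.I)‖₊ : ℝ≥0∞) ^ 2)

/-- The lattice gradient energy `∑ₓ ∑ᵢ |Φ_{x+eᵢ} - Φₓ|²` (forward differences around the torus;
Kapusta–Gale's `(∇φ₁)² + (∇φ₂)²` on the lattice, i.e. the nearest-neighbour hopping term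
`-∑ [φₓ^* φ_{x+ν̂} + c.c.]` of the lattice action plus its diagonal part).
[cite: GattringerKloiber2013, §2 (1)] -/
def gradientEnergy (Φ : Config d n) : ℝ≥0∞ :=
  ∑ x, ∑ i : Fin d, (‖Φ (x + Pi.single i 1) - Φ x‖₊ : ℝ≥0∞) ^ 2

/-- The potential energy of a configuration,
`U(Φ) = ∑ₓ W(|Φₓ|²) + ∑ₓ ∑ᵢ |Φ_{x+eᵢ} - Φₓ|² + ½ ∑ₓ ∑_y K(x,y) |Φₓ|² |Φ_y|²`.
[cite: KapustaGale2023, §2.4 (2.48)] -/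
def potential (H : RelativisticLatticeBoseGas d n) (Φ : Config d n) : ℝ≥0∞ :=
  ∑ x, H.W (‖Φ x‖ ^ 2) + gradientEnergy Φ +
    (∑ x, ∑ y, H.K x y * (‖Φ x‖₊ : ℝ≥0∞) ^ 2 * (‖Φ y‖₊ : ℝ≥0∞) ^ 2) / 2

/-- The energy (quadratic form) `⟨Ψ, HΨ⟩ = ∫ ((c²/2) ∑ₓ |∇_{Φₓ}Ψ|² + U(Φ) |Ψ(Φ)|²) dΦ ∈ [0, ∞]`
of a wave function, `H = ∑ₓ [(c²/2)(-Δ_{Φₓ}) + W(|Φₓ|²)] + gradient + ½ ∑ K |Φₓ|²|Φ_y|²`.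
[cite: KapustaGale2023, §2.4 (2.48)] -/
def energy (H : RelativisticLatticeBoseGas d n) (Ψ : Config d n → ℂ) : ℝ≥0∞ :=
  ∫⁻ Φ, ENNReal.ofReal (H.c ^ 2 / 2) * kineticDensity Ψ Φ + H.potential Φ * (‖Ψ Φ‖₊ : ℝ≥0∞) ^ 2

/-- Admissible trial wave functions: `Ψ : ℂ^{(ℤ/nℤ)^d} → ℂ` continuously (real-)differentiable
and normalised, `∫ |Ψ|² dΦ = 1`. This class contains `C_c^∞` and the polynomial-times-Gaussian
states, a form core of `H`, so infima over it are spectral infima. [folklore] -/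
structure TrialState (d n : ℕ) [NeZero n] where
  /-- The wave function `Ψ(Φ)`. -/
  ψ : Config d n → ℂ
  /-- `Ψ` is `C¹` (as a map of real normed spaces). -/
  contDiff : ContDiff ℝ 1 ψ
  /-- Normalisation `∫ |Ψ|² dΦ = 1`. -/
  norm_eq : ∫⁻ Φ, (‖ψ Φ‖₊ : ℝ≥0∞) ^ 2 = 1

/-- The (absolute) ground-state energy `E₀ = inf_Ψ ⟨Ψ, HΨ⟩` over all normalised trial states (no
charge constraint; "the absolute ground state energy is the infimum of `⟨Ψ|H|Ψ⟩` over all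
normalized `Ψ`"). [cite: LSSY2005, Ch. 2 (after (2.1))] -/
def groundStateEnergy (H : RelativisticLatticeBoseGas d n) : ℝ≥0∞ :=
  ⨅ Ψ : TrialState d n, H.energy Ψ.ψ

/-- The ground-state energy `E₀(N) = inf {⟨Ψ, HΨ⟩ : Ψ in the charge sector N}` of the sector of
charge `N` (the canonical relativistic Bose gas with `N` units of charge; `H` commutes with `Q`,
so this is the bottom of the spectrum of `H` restricted to `Q = N`). [folklore] -/
def sectorGroundStateEnergy (H : RelativisticLatticeBoseGas d n) (N : ℤ) : ℝ≥0∞ :=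
  ⨅ (Ψ : TrialState d n) (_ : IsInSector N Ψ.ψ), H.energy Ψ.ψ

/-! ### Order parameters -/

/-- The **zero-mode intensity** `⟨Ψ, |∑ₓ Φₓ|² Ψ⟩ = ∫ |∑ₓ Φₓ|² |Ψ(Φ)|² dΦ` — the expectation of the
squared `k = 0` Fourier mode `|Φ̂(0)|²` of the field (Kapusta–Gale's zero-momentum amplitude
`ζ²`, (2.52)); `= n^d (N₀ + 1)` in antiparticle-free states, `N₀` the zero-momentum occupation.
[cite: KapustaGale2023, §2.4 (2.52)] -/
def zeroModeIntensity (Ψ : Config d n → ℂ) : ℝ≥0∞ :=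
  ∫⁻ Φ, (‖∑ x, Φ x‖₊ : ℝ≥0∞) ^ 2 * (‖Ψ Φ‖₊ : ℝ≥0∞) ^ 2

/-- The site intensity `⟨Ψ, |Φₓ|² Ψ⟩ = ∫ |Φₓ|² |Ψ(Φ)|² dΦ` (the field expectation value `⟨|φ|²⟩`
of finite-density lattice field theory, per site). [folklore] -/
def siteIntensity (x : TorusSite d n) (Ψ : Config d n → ℂ) : ℝ≥0∞ :=
  ∫⁻ Φ, (‖Φ x‖₊ : ℝ≥0∞) ^ 2 * (‖Ψ Φ‖₊ : ℝ≥0∞) ^ 2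

/-- The zero-mode intensity **of the absolute ground state**, through minimising sequences:
`sup_{δ>0} inf {⟨|∑Φₓ|²⟩_Ψ : ⟨Ψ,HΨ⟩ ≤ E₀ + δ}` (for the unique ground state of the finite
system this is its zero-mode intensity; the device of `BoseGas.condensateNumber`). [folklore] -/
def groundStateZeroMode (H : RelativisticLatticeBoseGas d n) : ℝ≥0∞ :=
  ⨆ (δ : ℝ≥0∞) (_ : 0 < δ),
    ⨅ (Ψ : TrialState d n) (_ : H.energy Ψ.ψ ≤ H.groundStateEnergy + δ), zeroModeIntensity Ψ.ψ

/-- The zero-mode intensity **of the sector-`N` ground state**, through minimising sequences in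
the sector: `sup_{δ>0} inf {⟨|∑Φₓ|²⟩_Ψ : Ψ in sector N, ⟨Ψ,HΨ⟩ ≤ E₀(N) + δ}`. [folklore] -/
def sectorZeroMode (H : RelativisticLatticeBoseGas d n) (N : ℤ) : ℝ≥0∞ :=
  ⨆ (δ : ℝ≥0∞) (_ : 0 < δ),
    ⨅ (Ψ : TrialState d n) (_ : IsInSector N Ψ.ψ)
      (_ : H.energy Ψ.ψ ≤ H.sectorGroundStateEnergy N + δ), zeroModeIntensity Ψ.ψ

/-! ### The two site potentials and the kernel of the route; the anchor and corner models -/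

/-- The double-well (symmetry-breaking, "deep well") site potential `W(t) = lam (t - w)²`,
`t = |Φₓ|²` (i.e. `λ(|Φ|² - w)²`, the `m² < 0` phase of `m²|Φ|² + λ|Φ|⁴` up to a constant);
clipped to `0` if `lam < 0` (junk value, unused). [cite: KapustaGale2023, §2.4 (2.43)] -/
def doubleWell (lam w : ℝ) : ℝ → ℝ≥0∞ := fun t => ENNReal.ofReal (lam * (t - w) ^ 2)

/-- The mass term `W(t) = (c²/2) t`, `t = |Φₓ|²`: with the kinetic term `(c²/2)(-Δ_Φ)` each site
is a pair of oscillators of frequency `c²` (rest energy `mc²`, `m = 1`). [cite: KapustaGale2023, §2.4 (2.48)] -/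
def massTerm (c : ℝ) : ℝ → ℝ≥0∞ := fun t => ENNReal.ofReal (c ^ 2 / 2 * t)

/-- The position `b·x ∈ ℝ³` (`b = L/n`, representatives `xᵢ ∈ {0,…,n-1}`) of the site `x` of
`(ℤ/nℤ)³` in the periodic box of side `L`. [folklore] -/
def latticePos (L : ℝ) (n : ℕ) (x : TorusSite 3 n) : QuantumManyBody.BoseGas.Space :=
  WithLp.toLp 2 fun i => L / n * ((x i).val : ℝ)

/-- The discretised periodic pair kernel `K(x,y) = b² v^per(b x - b y)`, `b = L/n`, of a radial
profile `v` on the torus of side `L` (`v^per = BoseGas.periodizedPotential v L`, Fournais's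
periodisation); with hopping `1` the lattice form `b⁻²(-Δ_lat + K)` discretises `-Δ + v^per`.
[folklore] -/
def bornKernel (v : ℝ → ℝ≥0∞) (L : ℝ) (n : ℕ) (x y : TorusSite 3 n) : ℝ≥0∞ :=
  ENNReal.ofReal ((L / n) ^ 2) *
    QuantumManyBody.BoseGas.periodizedPotential v L (latticePos L n x - latticePos L n y)

/-- The **charge-conjugation symmetric anchor**: `H = ∑ₓ [(c²/2)(-Δ_{Φₓ}) + lam(|Φₓ|² - w)²] +
∑ₓ ∑ᵢ |Φ_{x+eᵢ} - Φₓ|²` (no pair kernel), a nearest-neighbour ferromagnet of two-component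
anharmonic oscillators. [cite: DriesslerLandauPerez1979, §1] -/
def anchor (d n : ℕ) (c lam w : ℝ) : RelativisticLatticeBoseGas d n :=
  ⟨c, doubleWell lam w, 0⟩

/-- The **non-relativistic corner**: mass term `(c²/2)|Φₓ|²` and the discretised periodic pair
kernel `b² v^per(b(x - y))`, `b = L/n`, `L = (N/ρ)^{1/3}` (`BoseGas.sideLength ρ N`), on
`(ℤ/nℤ)³`. [folklore] -/
def corner (n : ℕ) (c : ℝ) (v : ℝ → ℝ≥0∞) (ρ : ℝ) (N : ℕ) : RelativisticLatticeBoseGas 3 n :=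
  ⟨c, massTerm c, bornKernel v (QuantumManyBody.BoseGas.sideLength ρ N) n⟩

end RelativisticLatticeBoseGas

/-! ### Basic API -/

namespace RelativisticLatticeBoseGas

variable {d n : ℕ}

/-- Unfolding of the sector condition in the inline form used by route statements. [folklore] -/
theorem isInSector_iff (N : ℤ) (Ψ : Config d n → ℂ) :
    IsInSector N Ψ ↔ ∀ (θ : ℝ) (Φ : Config d n),
      Ψ (fun x => Complex.exp (θ * Complex.I) * Φ x) = Complex.exp (N * θ * Complex.I) * Ψ Φ :=
  Iff.rfl

/-- For a natural charge `N` the sector condition with the cast `(N : ℂ)` — the form typed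
inline by route statements quantifying over `N : ℕ`. [folklore] -/
theorem isInSector_natCast_iff (N : ℕ) (Ψ : Config d n → ℂ) :
    IsInSector N Ψ ↔ ∀ (θ : ℝ) (Φ : Config d n),
      Ψ (fun x => Complex.exp (θ * Complex.I) * Φ x) = Complex.exp (N * θ * Complex.I) * Ψ Φ := by
  simp only [IsInSector, Int.cast_natCast]
  rfl

/-- Unfolding of `phaseRotate`. [folklore] -/
@[simp]
theorem phaseRotate_apply (θ : ℝ) (Φ : Config d n) (x : TorusSite d n) :
    phaseRotate θ Φ x = Complex.exp (θ * Complex.I) * Φ x :=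
  rfl

/-- `‖e^{i t}‖₊ = 1`. [folklore] -/
theorem nnnorm_exp_mul_I (t : ℝ) : ‖Complex.exp (t * Complex.I)‖₊ = 1 := by
  ext; simp

/-- The rotation by `θ = 0` is the identity. [folklore] -/
@[simp]
theorem phaseRotate_zero (Φ : Config d n) : phaseRotate 0 Φ = Φ := by
  funext x; simp [phaseRotate]

/-- Gauge rotations preserve the modulus of every coordinate. [folklore] -/
@[simp]
theorem nnnorm_phaseRotate_apply (θ : ℝ) (Φ : Config d n) (x : TorusSite d n) :
    ‖phaseRotate θ Φ x‖₊ = ‖Φ x‖₊ := by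
  rw [phaseRotate_apply, nnnorm_mul, nnnorm_exp_mul_I, one_mul]

/-- In a fixed sector `|Ψ|` is gauge invariant: `|Ψ(e^{iθ}Φ)| = |Ψ(Φ)|`. [folklore] -/
theorem IsInSector.nnnorm_apply_phaseRotate {N : ℤ} {Ψ : Config d n → ℂ} (h : IsInSector N Ψ)
    (θ : ℝ) (Φ : Config d n) : ‖Ψ (phaseRotate θ Φ)‖₊ = ‖Ψ Φ‖₊ := by
  rw [h θ Φ, nnnorm_mul]
  have : ((N : ℂ) * θ * Complex.I) = ((N * θ : ℝ) : ℂ) * Complex.I := by push_cast; ring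
  rw [this, nnnorm_exp_mul_I, one_mul]

variable [NeZero n]

/-- Variational principle (absolute ground state). [cite: LSSY2005, Ch. 2 (after (2.1))] -/
theorem groundStateEnergy_le (H : RelativisticLatticeBoseGas d n) (Ψ : TrialState d n) :
    H.groundStateEnergy ≤ H.energy Ψ.ψ :=
  iInf_le _ Ψ

/-- Variational principle in the sector `N`. [folklore] -/
theorem sectorGroundStateEnergy_le (H : RelativisticLatticeBoseGas d n) {N : ℤ}
    (Ψ : TrialState d n) (hΨ : IsInSector N Ψ.ψ) : H.sectorGroundStateEnergy N ≤ H.energy Ψ.ψ :=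
  iInf₂_le Ψ hΨ

/-- The absolute ground-state energy lies below every sector energy. [folklore] -/
theorem groundStateEnergy_le_sectorGroundStateEnergy (H : RelativisticLatticeBoseGas d n) (N : ℤ) :
    H.groundStateEnergy ≤ H.sectorGroundStateEnergy N :=
  le_iInf₂ fun Ψ _ => groundStateEnergy_le H Ψ

/-- How sector condensation is *proved*: a uniform lower bound on the zero-mode intensity of
all `δ`-near-minimisers of the sector, for some `δ > 0`. [folklore] -/
theorem le_sectorZeroMode (H : RelativisticLatticeBoseGas d n) {N : ℤ} {δ m : ℝ≥0∞} (hδ : 0 < δ)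
    (h : ∀ Ψ : TrialState d n, IsInSector N Ψ.ψ →
      H.energy Ψ.ψ ≤ H.sectorGroundStateEnergy N + δ → m ≤ zeroModeIntensity Ψ.ψ) :
    m ≤ H.sectorZeroMode N :=
  le_iSup₂_of_le (f := fun δ _ => ⨅ (Ψ : TrialState d n) (_ : IsInSector N Ψ.ψ)
      (_ : H.energy Ψ.ψ ≤ H.sectorGroundStateEnergy N + δ), zeroModeIntensity Ψ.ψ) δ hδ
    (le_iInf fun Ψ => le_iInf₂ (h Ψ))

/-- The same for the absolute ground state. [folklore] -/
theorem le_groundStateZeroMode (H : RelativisticLatticeBoseGas d n) {δ m : ℝ≥0∞} (hδ : 0 < δ)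
    (h : ∀ Ψ : TrialState d n, H.energy Ψ.ψ ≤ H.groundStateEnergy + δ →
      m ≤ zeroModeIntensity Ψ.ψ) :
    m ≤ H.groundStateZeroMode :=
  le_iSup₂_of_le (f := fun δ _ => ⨅ (Ψ : TrialState d n)
      (_ : H.energy Ψ.ψ ≤ H.groundStateEnergy + δ), zeroModeIntensity Ψ.ψ) δ hδ (le_iInf₂ h)

/-! ### Unfolding the route's models -/

omit [NeZero n] in
/-- Unfolding of `doubleWell`. [folklore] -/
@[simp] theorem doubleWell_apply (lam w t : ℝ) :
    doubleWell lam w t = ENNReal.ofReal (lam * (t - w) ^ 2) := rfl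

omit [NeZero n] in
/-- Unfolding of `massTerm`. [folklore] -/
@[simp] theorem massTerm_apply (c t : ℝ) : massTerm c t = ENNReal.ofReal (c ^ 2 / 2 * t) := rfl

omit [NeZero n] in
/-- The anchor's speed of light. [folklore] -/
@[simp] theorem anchor_c (c lam w : ℝ) : (anchor d n c lam w).c = c := rfl

omit [NeZero n] in
/-- The anchor's site potential is the double well. [folklore] -/
@[simp] theorem anchor_W (c lam w : ℝ) : (anchor d n c lam w).W = doubleWell lam w := rfl

omit [NeZero n] in
/-- The anchor has no pair kernel. [folklore] -/
@[simp] theorem anchor_K (c lam w : ℝ) : (anchor d n c lam w).K = 0 := rfl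

omit [NeZero n] in
/-- The corner's speed of light. [folklore] -/
@[simp] theorem corner_c {n : ℕ} (c : ℝ) (v : ℝ → ℝ≥0∞) (ρ : ℝ) (N : ℕ) :
    (corner n c v ρ N).c = c := rfl

omit [NeZero n] in
/-- The corner's site potential is the mass term. [folklore] -/
@[simp] theorem corner_W {n : ℕ} (c : ℝ) (v : ℝ → ℝ≥0∞) (ρ : ℝ) (N : ℕ) :
    (corner n c v ρ N).W = massTerm c := rfl

omit [NeZero n] in
/-- The corner's pair kernel is the Born kernel at `L = (N/ρ)^{1/3}`. [folklore] -/
@[simp] theorem corner_K {n : ℕ} (c : ℝ) (v : ℝ → ℝ≥0∞) (ρ : ℝ) (N : ℕ) :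
    (corner n c v ρ N).K = bornKernel v (QuantumManyBody.BoseGas.sideLength ρ N) n := rfl

/-- The anchor's potential energy in closed form:
`U(Φ) = ∑ₓ lam(|Φₓ|² - w)² + ∑ₓ ∑ᵢ |Φ_{x+eᵢ} - Φₓ|²`. [cite: DriesslerLandauPerez1979, §1] -/
theorem anchor_potential (c lam w : ℝ) (Φ : Config d n) :
    (anchor d n c lam w).potential Φ =
      ∑ x, ENNReal.ofReal (lam * (‖Φ x‖ ^ 2 - w) ^ 2) + gradientEnergy Φ := by
  simp [potential]

end RelativisticLatticeBoseGas

end Literature.MathematicalPhysics.QuantumLattice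

end
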